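import Summits.ABC.ABC.Theses.CubicResolventAllowance

/-!
# Stub ideation k=3, generation 3 (family 3: probe the extremes) — `stub_realCubic` of crux
`IndexSzpiro` (stmt-ABC-22740), route `CubicResolventAllowance`.

Companion to `STUB-IDEAS-stub_realCubic-3.md` (gen 3).  `sorry` marks a PROPOSED helper; `sorry`-free
theorems are glue.  Nothing here claims the stub.  New in gen 3 (vs `StubIdeas3SketchG2.lean`):

* `fatExcess` and **Rung A⁺** (`RungAPlus`): the ε-free inequality
  `Δ_min ≤ C₀·|d_K|·N⁶·∏_{v_p(den j) ≥ 8} p^{v_p(den j)−6}` valid on the WHOLE irreducible-ψ₂ class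
  (both signs) — the quantitative "anatomy of a violator": gen-0 Rung A (`poles ≤ 7`) and the lower
  bound `fatExcess > (C/C₀)·N^ε` at every violation of the stub inequality are PROVED from it here;
* `DenjCoreReal` (k2's twist-invariant CORE C, `den j ≤ C·d_K·rad(den j)^{6+ε}`) and its NEGATION
  `not_denjCoreReal`, witnessed by the explicit additive-subsidy family `subsidyCurve a q`,
  `q = a³ − p^n` (kit job j344550): K-free cores must charge additive potentially-good primes.
* `exists_index_sq_eq` (N1★) is restated verbatim from gen 2 as the spine all glue runs on.
-/

set_option linter.dupNamespace false

noncomputable section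

namespace Summit.ABC.ABC.Cruxes.IndexSzpiro.StubIdeas3G3

open NumberField Polynomial
open Summit.ABC.ABC.Theses.CubicResolventAllowance

/-! ## The registered stub, verbatim -/

/-- `stub_realCubic` (the `d_K > 0` half of `IndexSzpiro`), verbatim registered signature. -/
def StubRealCubic : Prop :=
  ∀ ε : ℝ, 0 < ε → ∃ C : ℝ, ∀ (W : WeierstrassCurve ℚ) [W.IsElliptic] (K : Type) [Field K]
    [NumberField K], Irreducible W.twoTorsionPolynomial.toPoly → Module.finrank ℚ K = 3 →
    (∃ θ : K, Polynomial.aeval θ W.twoTorsionPolynomial.toPoly = 0) → 0 < NumberField.discr K →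
    (W.minimalDiscriminantNorm ℤ : ℝ) ≤
      C * |(NumberField.discr K : ℝ)| * (W.conductorNorm ℤ : ℝ) ^ (6 + ε)

/-! ## N1★ (spine, from gen 2) -/

/-- **N1★ (index identity, gen 2 `StubIdeas3G2.exists_index_sq_eq`, restated).**
`2⁸·Δ_min = I²·|d_K|` with `I = [𝓞_K : ℤ[4·x(P)]]`, `P ∈ E[2]`, on a global minimal model
(`twoTorsionPolynomial_discr`, `discr_family_eq_det_sq_mul_discr`,
`minimalDiscriminantNorm_eq_natAbs_holds`).  Size M. -/
theorem exists_index_sq_eq (W : WeierstrassCurve ℚ) [W.IsElliptic] (K : Type) [Field K]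
    [NumberField K] (hirr : Irreducible W.twoTorsionPolynomial.toPoly)
    (hdeg : Module.finrank ℚ K = 3)
    (hθ : ∃ θ : K, Polynomial.aeval θ W.twoTorsionPolynomial.toPoly = 0) :
    ∃ I : ℕ, 0 < I ∧ 2 ^ 8 * W.minimalDiscriminantNorm ℤ = I ^ 2 * (NumberField.discr K).natAbs := by
  sorry

/-! ## Rung A⁺ — fat-tower localisation (the ε-free anatomy of a violator) -/

section Fat

variable (W : WeierstrassCurve ℚ) [W.IsElliptic]

/-- Pole order of `j` at `p`: `v_p(den j) = max(0, −v_p(j))` (multiplicative: `n_p = v_p(Δ_min)`;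
potentially multiplicative `I_n^*`: `n`; integral `j` at `p`: `0`). -/
def poleOrder (p : ℕ) : ℕ := (W.j).den.factorization p

/-- **Fat excess** `∏_{p : v_p(den j) ≥ 8} p^{v_p(den j) − 6}` — the only place where `Δ_min` can
outrun `|d_K|·N⁶`: a pole of order `≤ 6` is paid by `p^{6·f_p}`, a pole of order `7` by
`p^{6 f_p}·p` with `p ∣ d_K` (parity law), additive potentially good primes by `p^{12} ≥ p^{10}`. -/
def fatExcess : ℕ :=
  ∏ p ∈ (W.j).den.primeFactors.filter (fun p => 8 ≤ (W.j).den.factorization p),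
    p ^ ((W.j).den.factorization p - 6)

/-- All poles `≤ 7` ⇒ no fat excess. -/
theorem fatExcess_eq_one_of_poles_le (h : ∀ p, poleOrder W p ≤ 7) : fatExcess W = 1 := by
  unfold fatExcess
  refine Finset.prod_eq_one ?_
  intro p hp
  exfalso
  have h7 := h p
  simp only [poleOrder, Finset.mem_filter] at h7 hp
  omega

end Fat

/-- **Rung A⁺ (proposed helper, M).**  On the whole irreducible-`ψ₂` class (no sign condition):
`Δ_min ≤ C₀ · |d_K| · N⁶ · fatExcess` for an absolute `C₀` (gen-0 certificate suggests `C₀ = 64`;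
the constant is prover business, hence `∃ C₀`).  Per prime: multiplicative `p ≥ 3` with `n_p ≤ 7`:
`p^{n_p} ≤ p⁶·p^{[n_p odd]}`, `p^{[n_p odd]} ∣ d_K` (parity law, gen-0 H4 / gen-2 N1c +
`factorization_discr_le_one_of_hasMultiplicativeReductionAt`); `n_p ≥ 8`: `p^{n_p} = p⁶·p^{n_p−6}`;
`I_n^*` at `p ≥ 5`: `v_p(Δ_min) = 6 + n ≤ 12 + [n odd] + (n−6)⁺`; potentially good `p ≥ 5`:
`v_p(Δ_min) ≤ 10 ≤ 12`; `p = 2, 3`: Ogg–Saito caps (`conductorExponent_le_eight_holds`,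
`…le_five_of_natGenerator_eq_three_holds`) absorbed in `C₀`.  Inputs: tree
`factorization_minimalDiscriminantNorm_holds`, `factorization_conductorNorm_holds`,
`DiscLeJHeight.ordMinimalDiscriminant_le_den_add_six`, `…le_conductorExponent_add_eight`. -/
def RungAPlus : Prop :=
  ∃ C₀ : ℝ, 0 < C₀ ∧ ∀ (W : WeierstrassCurve ℚ) [W.IsElliptic] (K : Type) [Field K] [NumberField K],
    Irreducible W.twoTorsionPolynomial.toPoly → Module.finrank ℚ K = 3 →
    (∃ θ : K, Polynomial.aeval θ W.twoTorsionPolynomial.toPoly = 0) →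
    (W.minimalDiscriminantNorm ℤ : ℝ) ≤
      C₀ * |(NumberField.discr K : ℝ)| * (W.conductorNorm ℤ : ℝ) ^ (6 : ℕ) * (fatExcess W : ℝ)

theorem rungAPlus : RungAPlus := by
  sorry

/-- **Rung A from Rung A⁺ (PROVED).** Poles `≤ 7` ⇒ `Δ_min ≤ C₀·|d_K|·N⁶` (ε-free stub instance on the
bounded-pole sub-class; gen 0 certified `C₀ = 64` on 3.0 M rung-class curves). -/
theorem rungA_of_rungAPlus (h : RungAPlus) :
    ∃ C₀ : ℝ, 0 < C₀ ∧ ∀ (W : WeierstrassCurve ℚ) [W.IsElliptic] (K : Type) [Field K] [NumberField K],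
      Irreducible W.twoTorsionPolynomial.toPoly → Module.finrank ℚ K = 3 →
      (∃ θ : K, Polynomial.aeval θ W.twoTorsionPolynomial.toPoly = 0) →
      (∀ p, poleOrder W p ≤ 7) →
      (W.minimalDiscriminantNorm ℤ : ℝ) ≤
        C₀ * |(NumberField.discr K : ℝ)| * (W.conductorNorm ℤ : ℝ) ^ (6 : ℕ) := by
  obtain ⟨C₀, hC₀, hA⟩ := h
  refine ⟨C₀, hC₀, ?_⟩
  intro W _ K _ _ hirr hdeg hθ hpoles
  have hup := hA W K hirr hdeg hθ
  rw [fatExcess_eq_one_of_poles_le W hpoles] at hup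
  simpa using hup

/-- **Anatomy of a violator (PROVED from Rung A⁺).** If `(W, K)` violates the stub inequality for
`(ε, C)`, then its fat excess exceeds `(C/C₀)·N^ε`: every counterexample carries multiplicative (or
`I_n^*`) towers of height `≥ 8` whose excess beats `N^ε` — the minimal-counterexample shape that the
gen-2 lattice search realises (one fat tower) and that `SingleTowerSzpiro` (stmt-ABC-22410) isolates. -/
theorem fatExcess_lower_bound_of_violation (h : RungAPlus) :
    ∃ C₀ : ℝ, 0 < C₀ ∧ ∀ (ε C : ℝ) (W : WeierstrassCurve ℚ) [W.IsElliptic] (K : Type) [Field K]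
      [NumberField K], Irreducible W.twoTorsionPolynomial.toPoly → Module.finrank ℚ K = 3 →
      (∃ θ : K, Polynomial.aeval θ W.twoTorsionPolynomial.toPoly = 0) →
      C * |(NumberField.discr K : ℝ)| * (W.conductorNorm ℤ : ℝ) ^ (6 + ε) <
        (W.minimalDiscriminantNorm ℤ : ℝ) →
      C * (W.conductorNorm ℤ : ℝ) ^ ε < C₀ * (fatExcess W : ℝ) := by
  obtain ⟨C₀, hC₀, hA⟩ := h
  refine ⟨C₀, hC₀, ?_⟩
  intro ε C W _ K _ _ hirr hdeg hθ hviol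
  have hup := hA W K hirr hdeg hθ
  have hN : 0 < (W.conductorNorm ℤ : ℝ) := by exact_mod_cast W.conductorNorm_pos_holds
  have hd : 0 < |(NumberField.discr K : ℝ)| := by
    rw [abs_pos]; exact_mod_cast NumberField.discr_ne_zero K
  have hsplit : (W.conductorNorm ℤ : ℝ) ^ (6 + ε) =
      (W.conductorNorm ℤ : ℝ) ^ (6 : ℕ) * (W.conductorNorm ℤ : ℝ) ^ ε := by
    rw [Real.rpow_add hN, show (6 : ℝ) = ((6 : ℕ) : ℝ) by norm_num, Real.rpow_natCast]
  rw [hsplit] at hviol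
  have hlt : C * (W.conductorNorm ℤ : ℝ) ^ ε * (|(NumberField.discr K : ℝ)| *
      (W.conductorNorm ℤ : ℝ) ^ (6 : ℕ)) <
      C₀ * (fatExcess W : ℝ) * (|(NumberField.discr K : ℝ)| * (W.conductorNorm ℤ : ℝ) ^ (6 : ℕ)) := by
    have h1 : C * |(NumberField.discr K : ℝ)| *
        ((W.conductorNorm ℤ : ℝ) ^ (6 : ℕ) * (W.conductorNorm ℤ : ℝ) ^ ε) =
        C * (W.conductorNorm ℤ : ℝ) ^ ε * (|(NumberField.discr K : ℝ)| *
          (W.conductorNorm ℤ : ℝ) ^ (6 : ℕ)) := by ring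
    have h2 : C₀ * |(NumberField.discr K : ℝ)| * (W.conductorNorm ℤ : ℝ) ^ (6 : ℕ) *
        (fatExcess W : ℝ) =
        C₀ * (fatExcess W : ℝ) * (|(NumberField.discr K : ℝ)| *
          (W.conductorNorm ℤ : ℝ) ^ (6 : ℕ)) := by ring
    rw [← h1, ← h2]
    exact lt_of_lt_of_le hviol hup
  exact lt_of_mul_lt_mul_right hlt (mul_pos hd (pow_pos hN 6)).le

/-! ## Autopsy: twist-invariant `den j`-cores with `d_K¹` are FALSE (additive cross-subsidy) -/

/-- k2's CORE C (`DenominatorCoreReal`), typed: `den(j) ≤ C·d_K·rad(den j)^{6+ε}` on the real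
irreducible class.  Twist-invariant; charges additive potentially-good primes only through `d_K¹`. -/
def DenjCoreReal : Prop :=
  ∀ ε : ℝ, 0 < ε → ∃ C : ℝ, ∀ (W : WeierstrassCurve ℚ) [W.IsElliptic] (K : Type) [Field K]
    [NumberField K], Irreducible W.twoTorsionPolynomial.toPoly → Module.finrank ℚ K = 3 →
    (∃ θ : K, Polynomial.aeval θ W.twoTorsionPolynomial.toPoly = 0) → 0 < NumberField.discr K →
    (((W.j).den : ℕ) : ℝ) ≤
      C * |(NumberField.discr K : ℝ)| * ((∏ p ∈ (W.j).den.primeFactors, p : ℕ) : ℝ) ^ (6 + ε)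

/-- **The additive-subsidy family** `E_{a,q} : y² = x³ − 3qa·x + 2q²`.  With `q = a³ − p^n > 0`
squarefree, `gcd(q, 6ap) = gcd(a, 6p) = 1`: `4A³ + 27B² = −108·q³·p^n`, `Δ = 2⁶3³·q³·p^n > 0`
(REAL class, `ψ₂ = 4(x³ − 3qa x + 2q²)` irreducible), `j = 1728·a³/p^n` (`den j = p^n`, one fat
multiplicative tower), every prime of `q` is additive of type III (`v(A)=1, v(B)=2, v(Δ)=3`, tame,
`e ∣ 4`, hence `v_ℓ(d_K) ≤ 1`), `N = 2^{f₂}3^{f₃}·p·rad(q)²`; `β := θ²/q ∈ 𝓞_K` has characteristic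
polynomial `x³ − 6a x² + 9a² x − 4q` of discriminant `2⁴3³·q·p^n`, so `|d_K| ∣ 2⁴3³·q·p^n`, and with the
parity law at `p` (`v_p(d_K) = [n odd]`): `|d_K| ≤ 2⁴3³·q·p` (observed: `2²·3^{1|3}·q·p^{[n odd]}`). -/
def subsidyCurve (a q : ℤ) : WeierstrassCurve ℚ := ⟨0, 0, 0, -3 * q * a, 2 * q ^ 2⟩

/-- `j` of the family (S: `c₄ = 144qa`, `Δ = 2⁶3³q³(a³ − q)`; `j = c₄³/Δ`). -/
theorem subsidyCurve_j (a q : ℤ) (hq : q ≠ 0) (haq : a ^ 3 - q ≠ 0)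
    [(subsidyCurve a q).IsElliptic] :
    (subsidyCurve a q).j = 1728 * (a : ℚ) ^ 3 / ((a : ℚ) ^ 3 - q) := by
  sorry

/-- **¬ CORE C (proposed NEGATIVE helper, M–L; certified numerically, kit j344550:
`log(den j/|d_K|)/log p` reaches `12.07` at `p^n = 7^{44}`, all 66 rows irreducible with `Δ, d_K > 0`).**  Along
`a = ⌈p^{n/3}⌉ + O(1)`, `q = a³ − p^n ≍ p^{2n/3}`: `den j = p^n` while
`d_K·rad(den j)^{6+ε} ≤ 2⁴3³·p^{7+ε}·q ≍ p^{2n/3 + 7 + ε}` — ratio `≍ p^{n/3−7−ε} → ∞`.  (The STUB is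
untouched: `N ⊇ rad(q)²` pays `q^{12}`.)  Lean inputs: `subsidyCurve_j`; `|d_K| ≤ |disc ℤ[β]|` for an
explicit `β ∈ 𝓞_K` of discriminant `2^a3^b·p^{[n odd]}·q` (or the local laws H4 + tame type-III bound);
irreducibility of `x³ − 3qa x + 2q²` (rational root test). -/
theorem not_denjCoreReal : ¬ DenjCoreReal := by
  sorry

/-! ## What the stub reduces to (unchanged): `IndexBound` of gen 2; here only the statement that
Rung A⁺ does NOT give an equivalent residual (thin-prime deficits subsidise fat towers, same
mechanism as the family above), recorded as the implication that IS available. -/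

/-- The sub-class with controlled fat excess: `fatExcess ≤ A·N^η`.  On it the stub holds with
exponent `6 + η` (PROVED from Rung A⁺); `η = 0, A = 1` is Rung A.  This is the honest reach of
per-prime bookkeeping — the complement (fat excess `> N^η`) is single/multi-tower Szpiro. -/
theorem stub_on_controlled_fatExcess (h : RungAPlus) (A η : ℝ) :
    ∃ C : ℝ, ∀ (W : WeierstrassCurve ℚ) [W.IsElliptic] (K : Type) [Field K] [NumberField K],
      Irreducible W.twoTorsionPolynomial.toPoly → Module.finrank ℚ K = 3 →
      (∃ θ : K, Polynomial.aeval θ W.twoTorsionPolynomial.toPoly = 0) →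
      (fatExcess W : ℝ) ≤ A * (W.conductorNorm ℤ : ℝ) ^ η →
      (W.minimalDiscriminantNorm ℤ : ℝ) ≤
        C * |(NumberField.discr K : ℝ)| * (W.conductorNorm ℤ : ℝ) ^ (6 + η) := by
  obtain ⟨C₀, hC₀, hR⟩ := h
  refine ⟨C₀ * A, ?_⟩
  intro W _ K _ _ hirr hdeg hθ hfat
  have hup := hR W K hirr hdeg hθ
  have hN : 0 < (W.conductorNorm ℤ : ℝ) := by exact_mod_cast W.conductorNorm_pos_holds
  have hd : 0 ≤ |(NumberField.discr K : ℝ)| := abs_nonneg _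
  have hsplit : (W.conductorNorm ℤ : ℝ) ^ (6 + η) =
      (W.conductorNorm ℤ : ℝ) ^ (6 : ℕ) * (W.conductorNorm ℤ : ℝ) ^ η := by
    rw [Real.rpow_add hN, show (6 : ℝ) = ((6 : ℕ) : ℝ) by norm_num, Real.rpow_natCast]
  have hK : 0 ≤ C₀ * |(NumberField.discr K : ℝ)| * (W.conductorNorm ℤ : ℝ) ^ (6 : ℕ) :=
    mul_nonneg (mul_nonneg hC₀.le hd) (pow_nonneg hN.le 6)
  calc (W.minimalDiscriminantNorm ℤ : ℝ)
        ≤ C₀ * |(NumberField.discr K : ℝ)| * (W.conductorNorm ℤ : ℝ) ^ (6 : ℕ) * (fatExcess W : ℝ) :=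
          hup
    _ ≤ C₀ * |(NumberField.discr K : ℝ)| * (W.conductorNorm ℤ : ℝ) ^ (6 : ℕ) *
          (A * (W.conductorNorm ℤ : ℝ) ^ η) := mul_le_mul_of_nonneg_left hfat hK
    _ = C₀ * A * |(NumberField.discr K : ℝ)| * (W.conductorNorm ℤ : ℝ) ^ (6 + η) := by
          rw [hsplit]; ring

end Summit.ABC.ABC.Cruxes.IndexSzpiro.StubIdeas3G3
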